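import Summits.ResolutionOfSingularities.ResolutionOfSingularities.Theses.AbhyankarShadows
import Summits.ResolutionOfSingularities.ResolutionOfSingularities.Theses.IndSmooth
import Literature.AlgebraicGeometry.Resolution.ProperModelsPatchingOfResolution

/-!
# Negative lemmas for crux `PatchingPerfect` (stmt-ResolutionOfSingularities-16089): why it
# resists refutation, and its exact open content — fieldwise

`PatchingPerfect` (rank 4 of routes `AbhyankarShadows` and `IndSmooth`, one term:
`indSmooth_patchingPerfect_iff`) reads, for every prime `p` and every PERFECT field `k` of
characteristic `p`: relative local uniformization over `k` (`RelLU_k`: every finitely generated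
`R ⊆ O` of a finitely generated `K/k`, `O ∋ k` a valuation ring, is dominated by a finitely
generated `A ⊆ O` with `Frac A = K`, regular at the centre of `O`) implies weak resolution of
every reduced separated `k`-scheme of finite type (`Res_k`).

Findings of the standing disprover (cycle 1, `Cruxes/PatchingPerfect/Disproof.lean` §1), all
unconditional:

* `patchingPerfect_relLU_of_resolves` — the CONVERSE implication `Res_k → RelLU_k` is a theorem
  for every field `k` (Zariski 1940 read backwards, over the tree's
  `exists_affineModel_regular_of_hasResolution`);
* `patchingPerfect_iff_relLU_iff_resolves` — so the crux says `RelLU_k ↔ Res_k` over perfect `k`;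
* `not_patchingPerfect_iff` — a refutation must PROVE `RelLU_k` over some perfect `k` (every
  transcendence degree; open from 4) AND refute weak resolution over the same `k`: no degenerate,
  finite or computational instance exists;
* `patchingPerfect_iff_relLU_imp_properTwoModelPatching` — EXACT OPEN CONTENT, fieldwise: the
  crux is equivalent to "`RelLU_k` ⇒ two-model patching of proper models of every `K/k`"
  (Piltant 2013, Prop. 5.1 with `P = P_reg`; open in transcendence degree `≥ 4`), both
  directions over the tree's per-field Zariski–Piltant engine
  (`resolutionOverUpToDim_of_properPatching_of_relLU`) and `ProperModel.join`; perfectness of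
  `k` is consumed by neither direction.
-/

noncomputable section

set_option linter.dupNamespace false

open CategoryTheory AlgebraicGeometry
open Literature.AlgebraicGeometry.Resolution
open Summit.ResolutionOfSingularities.ResolutionOfSingularities.Theses
open Summit.ResolutionOfSingularities.ResolutionOfSingularities.Theses.AbhyankarShadows
  (PatchingPerfect)

namespace Summit.ResolutionOfSingularities.ResolutionOfSingularities.Theorems.PatchingPerfect.Negative

/-- The two route copies of the crux are one term (definitional). [folklore] -/
theorem indSmooth_patchingPerfect_iff : IndSmooth.PatchingPerfect ↔ PatchingPerfect :=
  Iff.rfl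

/-- **Weak resolution over `k` implies relative local uniformization over `k`**, for EVERY field
`k`: enlarge the prescribed `R` by an affine model of `O`, resolve its spectrum, read off a
regular affine model at the centre. The converse of the crux's implication, fieldwise.
[folklore] -/
theorem patchingPerfect_relLU_of_resolves (k : Type) [Field k]
    (h : (∀ (X : Scheme.{0}) (f : X ⟶ Spec (.of k)), IsSeparated f → LocallyOfFiniteType f →
      QuasiCompact f → IsReduced X → Scheme.HasResolution X)) :
    (∀ (K : Type) [Field K] [Algebra k K], (⊤ : IntermediateField k K).FG →
      ∀ O : ValuationSubring K, (∀ c : k, algebraMap k K c ∈ O) → ∀ R : Subalgebra k K, R.FG →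
        R.toSubring ≤ O.toSubring → ∃ (A : Subalgebra k K) (h : A.toSubring ≤ O.toSubring),
          R ≤ A ∧ A.FG ∧ IsFractionRing A K ∧ IsRegularLocalRing (Localization.AtPrime
            (Ideal.comap (Subring.inclusion h) (IsLocalRing.maximalIdeal O)))) := by
  intro K _ _ hKfg O hO R hRfg hRO
  obtain ⟨A₀, hA₀O, hA₀fg, hA₀fr⟩ := exists_affineModel k K hKfg O hO
  have hR'O : (R ⊔ A₀).toSubring ≤ O.toSubring := by
    let Oalg : Subalgebra k K := { O.toSubring with algebraMap_mem' := hO }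
    change R ⊔ A₀ ≤ Oalg
    exact sup_le (fun x hx => hRO hx) (fun x hx => hA₀O hx)
  have hR'fr : IsFractionRing ↥(R ⊔ A₀) K := isFractionRing_of_le le_sup_right hA₀fr
  have hR'fg : (R ⊔ A₀).FG := hRfg.sup hA₀fg
  haveI : Algebra.FiniteType k ↥(R ⊔ A₀) := (R ⊔ A₀).fg_iff_finiteType.mp hR'fg
  let f : Spec (.of ↥(R ⊔ A₀)) ⟶ Spec (.of k) :=
    Spec.map (CommRingCat.ofHom (algebraMap k ↥(R ⊔ A₀)))
  haveI : LocallyOfFiniteType f :=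
    (HasRingHomProperty.Spec_iff (P := @LocallyOfFiniteType)).mpr
      (RingHom.finiteType_algebraMap.mpr ‹_›)
  have hres : Scheme.HasResolution (Spec (.of ↥(R ⊔ A₀))) :=
    h _ f inferInstance inferInstance inferInstance inferInstance
  obtain ⟨A, hA, hle, hAfg, hreg⟩ :=
    exists_affineModel_regular_of_hasResolution O (R ⊔ A₀) hR'O hR'fg hR'fr hres
  exact ⟨A, hA, le_sup_left.trans hle, hAfg, isFractionRing_of_le hle hR'fr, hreg⟩

/-- **The crux asserts that relative LU and weak resolution are EQUIVALENT over every perfect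
field** (one direction being `patchingPerfect_relLU_of_resolves`). [folklore] -/
theorem patchingPerfect_iff_relLU_iff_resolves :
    PatchingPerfect ↔ ∀ p : ℕ, p.Prime → ∀ (k : Type) [Field k] [CharP k p] [PerfectField k],
      ((∀ (K : Type) [Field K] [Algebra k K], (⊤ : IntermediateField k K).FG →
      ∀ O : ValuationSubring K, (∀ c : k, algebraMap k K c ∈ O) → ∀ R : Subalgebra k K, R.FG →
        R.toSubring ≤ O.toSubring → ∃ (A : Subalgebra k K) (h : A.toSubring ≤ O.toSubring),
          R ≤ A ∧ A.FG ∧ IsFractionRing A K ∧ IsRegularLocalRing (Localization.AtPrime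
            (Ideal.comap (Subring.inclusion h) (IsLocalRing.maximalIdeal O)))) ↔
      (∀ (X : Scheme.{0}) (f : X ⟶ Spec (.of k)), IsSeparated f → LocallyOfFiniteType f →
      QuasiCompact f → IsReduced X → Scheme.HasResolution X)) :=
  ⟨fun h p hp k _ _ _ => ⟨h p hp k, patchingPerfect_relLU_of_resolves k⟩,
    fun h p hp k _ _ _ => (h p hp k).1⟩

/-- **What a refutation of the crux must exhibit**: a prime `p` and a perfect field `k` of
characteristic `p` over which relative LU HOLDS in every transcendence degree while weak
resolution FAILS. [folklore] -/
theorem not_patchingPerfect_iff :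
    ¬ PatchingPerfect ↔ ∃ (p : ℕ) (_ : p.Prime) (k : Type) (_ : Field k) (_ : CharP k p)
      (_ : PerfectField k),
      (∀ (K : Type) [Field K] [Algebra k K], (⊤ : IntermediateField k K).FG →
      ∀ O : ValuationSubring K, (∀ c : k, algebraMap k K c ∈ O) → ∀ R : Subalgebra k K, R.FG →
        R.toSubring ≤ O.toSubring → ∃ (A : Subalgebra k K) (h : A.toSubring ≤ O.toSubring),
          R ≤ A ∧ A.FG ∧ IsFractionRing A K ∧ IsRegularLocalRing (Localization.AtPrime
            (Ideal.comap (Subring.inclusion h) (IsLocalRing.maximalIdeal O)))) ∧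
      ¬ (∀ (X : Scheme.{0}) (f : X ⟶ Spec (.of k)), IsSeparated f → LocallyOfFiniteType f →
      QuasiCompact f → IsReduced X → Scheme.HasResolution X) := by
  constructor
  · intro h
    by_contra hne
    apply h
    intro p hp k _ _ _ hLU
    by_contra hres
    exact hne ⟨p, hp, k, inferInstance, inferInstance, inferInstance, hLU, hres⟩
  · rintro ⟨p, hp, k, hk, hc, hperf, hLU, hres⟩ h
    exact hres (h p hp k hLU)

/-- **Weak resolution over `k` gives two-model patching of proper models over `k`** (resolve the
join; a regular model is `RegLe` over anything). [folklore] -/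
theorem patchingPerfect_properTwoModelPatching_of_resolves (k : Type) [Field k]
    (h : (∀ (X : Scheme.{0}) (f : X ⟶ Spec (.of k)), IsSeparated f → LocallyOfFiniteType f →
      QuasiCompact f → IsReduced X → Scheme.HasResolution X)) :
    (∀ (K : Type) [Field K] [Algebra k K] [Algebra.EssFiniteType k K],
      ∀ M₁ M₂ : ProperModel k K,
        ∃ (N : ProperModel k K) (φ₁ : N.Hom M₁) (φ₂ : N.Hom M₂), φ₁.RegLe ∧ φ₂.RegLe) := by
  intro K _ _ _ M₁ M₂
  obtain ⟨N, φ, hN⟩ := (ProperModel.join M₁ M₂).exists_hom_isRegular_of_hasResolution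
    (h _ (ProperModel.join M₁ M₂).π inferInstance inferInstance inferInstance inferInstance)
  exact ⟨N, φ.comp (ProperModel.joinFst M₁ M₂), φ.comp (ProperModel.joinSnd M₁ M₂),
    fun y _ => hN y, fun y _ => hN y⟩

/-- **Zariski–Piltant engine at one field**: two-model patching of proper models over `k` and
relative LU over `k` give weak resolution over `k` (the body of the tree's
`resolutionInChar_of_properTwoModelPatching_of_relLU`, which uses its hypotheses at the one field
only; no perfectness, no characteristic). [cite: Piltant2013, Prop. 5.1 and Cor. 5.7] -/
theorem patchingPerfect_resolves_of_properTwoModelPatching_of_relLU (k : Type) [Field k]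
    (hZ : (∀ (K : Type) [Field K] [Algebra k K] [Algebra.EssFiniteType k K],
      ∀ M₁ M₂ : ProperModel k K,
        ∃ (N : ProperModel k K) (φ₁ : N.Hom M₁) (φ₂ : N.Hom M₂), φ₁.RegLe ∧ φ₂.RegLe))
    (hLU : (∀ (K : Type) [Field K] [Algebra k K], (⊤ : IntermediateField k K).FG →
      ∀ O : ValuationSubring K, (∀ c : k, algebraMap k K c ∈ O) → ∀ R : Subalgebra k K, R.FG →
        R.toSubring ≤ O.toSubring → ∃ (A : Subalgebra k K) (h : A.toSubring ≤ O.toSubring),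
          R ≤ A ∧ A.FG ∧ IsFractionRing A K ∧ IsRegularLocalRing (Localization.AtPrime
            (Ideal.comap (Subring.inclusion h) (IsLocalRing.maximalIdeal O))))) :
    (∀ (X : Scheme.{0}) (f : X ⟶ Spec (.of k)), IsSeparated f → LocallyOfFiniteType f →
      QuasiCompact f → IsReduced X → Scheme.HasResolution X) := by
  intro X f hs hl hq hr
  haveI : QuasiCompact f := hq
  haveI : LocallyOfFiniteType f := hl
  haveI : CompactSpace X := QuasiCompact.compactSpace_of_compactSpace f
  obtain ⟨d, hd⟩ := exists_topologicalKrullDim_le_of_locallyOfFiniteType f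
  have hLU' : ∀ (K : Type) [Field K] [Algebra k K] (O : ValuationSubring K) (R : Subalgebra k K),
      R.FG → IsFractionRing R K → R.toSubring ≤ O.toSubring →
        ∃ (A : Subalgebra k K) (h : A.toSubring ≤ O.toSubring), R ≤ A ∧ A.FG ∧
          IsRegularLocalRing (Localization.AtPrime
            (Ideal.comap (Subring.inclusion h) (IsLocalRing.maximalIdeal O))) := by
    intro K _ _ O R hRfg hRfr hRO
    haveI : Algebra.FiniteType k R := R.fg_iff_finiteType.mp hRfg
    haveI : Algebra.EssFiniteType R K :=
      Algebra.EssFiniteType.of_isLocalization K (nonZeroDivisors R)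
    have hKfg : (⊤ : IntermediateField k K).FG :=
      IntermediateField.fg_top_iff.mpr (Algebra.EssFiniteType.comp k R K)
    obtain ⟨A, h, hle, hAfg, -, hreg⟩ :=
      hLU K hKfg O (fun c => hRO (R.algebraMap_mem c)) R hRfg hRO
    exact ⟨A, h, hle, hAfg, hreg⟩
  exact resolutionOverUpToDim_of_properPatching_of_relLU hZ hLU' d X f hs hl hq hr hd

/-- **EXACT OPEN CONTENT, fieldwise**: the crux is equivalent to "relative LU over a perfect `k`
implies two-model patching of proper models of every `K/k`" (Piltant 2013, Prop. 5.1 with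
`P = P_reg`; open in transcendence degree `≥ 4`). [cite: Piltant2013, Prop. 5.1 and p. 2] -/
theorem patchingPerfect_iff_relLU_imp_properTwoModelPatching :
    PatchingPerfect ↔ ∀ p : ℕ, p.Prime → ∀ (k : Type) [Field k] [CharP k p] [PerfectField k],
      (∀ (K : Type) [Field K] [Algebra k K], (⊤ : IntermediateField k K).FG →
      ∀ O : ValuationSubring K, (∀ c : k, algebraMap k K c ∈ O) → ∀ R : Subalgebra k K, R.FG →
        R.toSubring ≤ O.toSubring → ∃ (A : Subalgebra k K) (h : A.toSubring ≤ O.toSubring),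
          R ≤ A ∧ A.FG ∧ IsFractionRing A K ∧ IsRegularLocalRing (Localization.AtPrime
            (Ideal.comap (Subring.inclusion h) (IsLocalRing.maximalIdeal O)))) →
      (∀ (K : Type) [Field K] [Algebra k K] [Algebra.EssFiniteType k K],
      ∀ M₁ M₂ : ProperModel k K,
        ∃ (N : ProperModel k K) (φ₁ : N.Hom M₁) (φ₂ : N.Hom M₂), φ₁.RegLe ∧ φ₂.RegLe) :=
  ⟨fun h p hp k _ _ _ hLU => patchingPerfect_properTwoModelPatching_of_resolves k (h p hp k hLU),
    fun h p hp k _ _ _ hLU =>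
      patchingPerfect_resolves_of_properTwoModelPatching_of_relLU k (h p hp k hLU) hLU⟩

end Summit.ResolutionOfSingularities.ResolutionOfSingularities.Theorems.PatchingPerfect.Negative

end
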